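import Summits.ABC.ABC.Theses.IsogenyGlueCongruence
import Summits.ABC.ABC.Theorems.IsogenyGlueCongruenceSemistableHeightPolyBound
import Summits.ABC.ABC.Theorems.IsogenyGlueCongruenceModularDatumExists
import Summits.ABC.ABC.Theorems.IsogenyGlueCongruenceDegreePrimesPolyBoundedStubModularity
import HarnessLib

/-!
# Route `IsogenyGlueCongruence`, support item `SemistableHeightPolyBound` (stmt-ABC-13918) —
# the item from the SEMISTABLE slice of modularity and Mazur–Kenku

Item `stmt-ABC-13918` (`∃ c, h_F(E) ≤ c · N_E²` for every semistable elliptic `E/ℚ` given by a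
global minimal model `W`, `h_F = WeierstrassCurve.stableFaltingsHeight`, `N_E = W.conductorNorm ℤ`)
is landed in the tree from three trust bases, all through the classical modular approach
(Frey; Murty–Pasten 2013; Pasten 2024 §3): Pasten's Thm 1.9 (`pasten2024_height_lt`,
`semistableHeightPolyBound_of_pasten2024_height_lt`), and the FULL Modularity Theorem in datum form
together with Mazur–Kenku (`semistableHeightPolyBound_of_modularity_of_mazurKenku_of_thm_5_5`, whose
third input, Pasten's Thm 5.5, is the tree theorem `PastenShimura2024_thm_5_5_holds`; packaged over
the route items as `semistableHeightPolyBoundOfMazurKenku_proof :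
MazurKenkuBound → ModularDatumExists → SemistableHeightPolyBound`). Those deductions never use the
item's semistability hypothesis.

This file uses it, to shrink the modularity input to its SEMISTABLE SLICE — the only curves the
item talks about. The chain (EqHDeg) → `h(E/ℚ) ≤ ½ N log N + 9` (`N ≫ 1`) → Shafarevich below the
threshold applies modularity only to the curve at hand; it is re-threaded per curve in
`DegreePrimesPolyBounded.exists_faltingsHeight_le_sq_of_nonempty` (`h(E/ℚ) ≤ c N²` for every
globally minimal elliptic `W/ℚ` WITH A DATUM, from Mazur–Kenku alone), and `h_F(E) = h(E/ℚ)` for a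
semistable curve (`stableFaltingsHeight_eq_faltingsHeight_of_isSemistable`; only `≤`,
`stableFaltingsHeight_le_faltingsHeight_rat`, is needed). Hence:

* `semistableHeightPolyBound_of_semistableModularDatum_of_mazurKenku` — the item from
  (1) a datum for every SEMISTABLE globally minimal elliptic `W/ℚ` at level `N_W` and
  (2) `PastenShimura2024_minimalDegree_le_163_mul` (Mazur–Kenku in Pasten's degree form);
* `semistableHeightPolyBound_of_CDT_theorem_7_1_2_of_mazurKenku` — the item from the named fact
  `BCDT.CDT_theorem_7_1_2` (Conrad–Diamond–Taylor 1999, Thm. 7.1.2: `27 ∤ N_E ⟹ E` modular; for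
  semistable curves this is Wiles 1995 Thm. 0.4 with Taylor–Wiles) and Mazur–Kenku, through the
  tree theorem `nonempty_modularParametrizationData_of_isSemistable_of_CDT_theorem_7_1_2`;
* `semistableHeightPolyBound_of_CDT_theorem_7_1_2_of_mazurKenkuBound` — the same with Mazur–Kenku
  spelled as the route item `MazurKenkuBound` (stmt-ABC-15125, definitionally the fact).

So the trust base of the item shrinks from {BCDT Thm. A (`exists_isNewformOf` ⟺
`ModularDatumExists`), Mazur–Kenku} to {CDT Thm. 7.1.2, Mazur–Kenku}. Both remaining inputs are
theorems in print and named facts of the tree; neither is discharged here (the item stays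
CONDITIONAL). No new definition.

## References

* [MurtyPasten2013] M. R. Murty, H. Pasten, *Modular forms and effective Diophantine
  approximation*, J. Number Theory 133 (2013) 3739–3754, Thm 1.1 (`h(E) ≪ N log N`).
* [PastenShimura2024] H. Pasten, *Shimura curves and the abc conjecture*, J. Number Theory 254
  (2024) 214–335 = arXiv:1705.09251: §3 p. 13 ((EqHDeg), Mazur–Kenku), Thm 5.5, Thm 7.2.
* [ConradDiamondTaylor1999] B. Conrad, F. Diamond, R. Taylor, *Modularity of certain potentially
  Barsotti–Tate Galois representations*, J. Amer. Math. Soc. 12 (1999) 521–567, Thm. 7.1.2.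
* [Wiles1995] A. Wiles, *Modular elliptic curves and Fermat's Last Theorem*, Ann. of Math. 141
  (1995), Thm. 0.4.
* [Silverman1986] J. H. Silverman, *Heights and elliptic curves*, in Arithmetic Geometry (1986),
  §2 (`𝔇 = Δ_{E/K}` for semistable `E/K`).
-/

noncomputable section

-- `Summit.<Summit>.<Problem>` is the mandated summit-side namespace (CONVENTIONS §2); for the
-- single-conjunct summit `ABC` the two coincide, so the duplicate `ABC.ABC` is deliberate.
set_option linter.dupNamespace false

namespace Summit.ABC.ABC.Theorems

open Literature.NumberTheory.EllipticCurves
open Literature.NumberTheory.EllipticCurves.ModularForms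
open Literature.NumberTheory.Automorphic
open Summit.ABC.ABC.Theses.IsogenyGlueCongruence

/-- **`SemistableHeightPolyBound` from the semistable slice of modularity and Mazur–Kenku.** If
(1) every SEMISTABLE elliptic `W/ℚ` given by a globally minimal model carries a modular
parametrisation datum at level `N_W` (Wiles 1995 Thm. 0.4 + Taylor–Wiles, in datum form) and
(2) `PastenShimura2024_minimalDegree_le_163_mul` holds (Mazur 1978 + Kenku 1982 via Pasten 2024 §3:
the minimal parametrisation degree of a globally minimal curve of the class is `≤ 163 · δ_{1,N}`),
then there is an absolute `c` with `h_F(E) ≤ c · N_E²` for every semistable elliptic `E/ℚ` in global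
minimal form. Proof: `h_F(E) ≤ h(E/ℚ)` (`stableFaltingsHeight_le_faltingsHeight_rat`) and
`h(E/ℚ) ≤ c N²` for every globally minimal curve with a datum
(`DegreePrimesPolyBounded.exists_faltingsHeight_le_sq_of_nonempty`: (EqHDeg), Pasten's Thm 5.5 —
the tree theorem `PastenShimura2024_thm_5_5_holds` —, the trivial Hecke bound, Shafarevich below the
threshold), the datum being supplied by (1) exactly on the semistable curves of the item.
CONDITIONAL on (1) and (2). [cite: MurtyPasten2013, Thm 1.1]
[cite: PastenShimura2024, §3 p. 13, Thm. 5.5, Thm. 7.2] -/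
theorem semistableHeightPolyBound_of_semistableModularDatum_of_mazurKenku
    (hslice : ∀ (W : WeierstrassCurve ℚ) [W.IsElliptic] [W.IsGloballyMinimal]
      [NeZero (W.conductorNorm ℤ)], W.IsSemistable ℤ →
        Nonempty (ModularParametrizationData W (W.conductorNorm ℤ)))
    (h163 : PastenShimura2024_minimalDegree_le_163_mul) : SemistableHeightPolyBound := by
  unfold SemistableHeightPolyBound
  obtain ⟨c, hc⟩ := DegreePrimesPolyBounded.exists_faltingsHeight_le_sq_of_nonempty h163
  exact ⟨c, fun W _ _ _ hss =>
    (stableFaltingsHeight_le_faltingsHeight_rat W).trans (hc W (hslice W hss))⟩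

/-- **`SemistableHeightPolyBound` from Conrad–Diamond–Taylor 1999, Thm. 7.1.2, and Mazur–Kenku.**
The modularity slice of `semistableHeightPolyBound_of_semistableModularDatum_of_mazurKenku` is
supplied by the named fact `BCDT.CDT_theorem_7_1_2` (an elliptic curve over `ℚ` whose conductor is
not divisible by `27` is modular; contains Wiles 1995 Thm. 0.4 / Taylor–Wiles for semistable
curves) through the tree theorem
`nonempty_modularParametrizationData_of_isSemistable_of_CDT_theorem_7_1_2` (a semistable curve has
squarefree conductor, so `27 ∤ N_W`). CONDITIONAL on `BCDT.CDT_theorem_7_1_2` and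
`PastenShimura2024_minimalDegree_le_163_mul` — the item's trust base no longer contains the full
Modularity Theorem (BCDT Thm. A). [cite: ConradDiamondTaylor1999, Thm. 7.1.2]
[cite: PastenShimura2024, §3 p. 13] -/
theorem semistableHeightPolyBound_of_CDT_theorem_7_1_2_of_mazurKenku
    (h712 : BCDT.CDT_theorem_7_1_2) (h163 : PastenShimura2024_minimalDegree_le_163_mul) :
    SemistableHeightPolyBound :=
  semistableHeightPolyBound_of_semistableModularDatum_of_mazurKenku
    (fun W _ _ _ hW ↦ nonempty_modularParametrizationData_of_isSemistable_of_CDT_theorem_7_1_2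
      h712 W hW)
    h163

/-- **`SemistableHeightPolyBound` from CDT Thm. 7.1.2 and the route item `MazurKenkuBound`**
(stmt-ABC-15125, whose body is definitionally `PastenShimura2024_minimalDegree_le_163_mul`): the
form in which the item is consumed by the route — the glue
`semistableHeightPolyBoundOfMazurKenku_proof : MazurKenkuBound → ModularDatumExists → item` with its
second hypothesis (all of BCDT Thm. A) weakened to the semistable case.
CONDITIONAL on `BCDT.CDT_theorem_7_1_2` and `MazurKenkuBound`. [cite: ConradDiamondTaylor1999, Thm. 7.1.2]
[cite: PastenShimura2024, §3 p. 13] -/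
theorem semistableHeightPolyBound_of_CDT_theorem_7_1_2_of_mazurKenkuBound
    (h712 : BCDT.CDT_theorem_7_1_2) (hMK : MazurKenkuBound) : SemistableHeightPolyBound :=
  semistableHeightPolyBound_of_CDT_theorem_7_1_2_of_mazurKenku h712 hMK

end Summit.ABC.ABC.Theorems

end
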